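import Mathlib
import Summits.AtomisticToContinuum.Crystallization.Theorems.ChargedEnergyGap.Negative.Unconditional
import Summits.AtomisticToContinuum.Crystallization.Theorems.ChessboardParticlePlanesLjLaminarWindowsAveragingIntegrals
import Literature.MathematicalPhysics.StatisticalMechanics.LennardJonesClusters
import HarnessLib

/-! # Shell bound — stub `stub_shellBound` of line `Sketch`, crux `LjLaminarWindows` (stmt-AtomisticToContinuum-6711)

For a `7/10`-separated configuration `x : Fin N → ℝ³`, a centre particle `i` and a radius `L`,
the attraction across the boundary of the particle-centred closed ball `B = {j : |x_j − x_i| ≤ L}`,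
`Σ_{j ∈ B} Σ_{k ∉ B} max(−V_LJ(|x_j − x_k|), 0)`, is at most
`ε · #B + C · #{j : L − R < |x_j − x_i| ≤ L}` with `R = R(ε) ≥ 1` and an absolute constant `C > 0`:
the attractive part of `V_LJ` is `≤ r⁻⁶/6`; a deep particle `j` (`|x_j − x_i| ≤ L − R`) sees
every exterior particle at distance `> R`, so its row sum is
`≤ R⁻¹ · Σ_k |x_j − x_k|⁻⁵ / 6 ≤ R⁻¹ · 250 (10/7)⁵ / 6 ≤ ε`, while a shell particle has row sum
`≤ (10/7) · 250 (10/7)⁵ / 6 =: C` (shell sum with exponent `5`, `averaging_sum_inv_pow_five_le`).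
All `[folklore]`.
-/

noncomputable section

open scoped BigOperators
open Literature.MathematicalPhysics.StatisticalMechanics
open Summit.AtomisticToContinuum.Crystallization.Theorems.ChargedEnergyGapNegative

namespace Summit.AtomisticToContinuum.Crystallization.Theorems.LjLaminarWindowsSketch

/-- The attractive part of the Lennard-Jones potential: `max(−V_LJ(r), 0) ≤ r⁻⁶/6`
(`−V_LJ(r) = r⁻⁶/6 − r⁻¹²/12`). [folklore] -/
private theorem shellBound_max_neg_lennardJones_le (r : ℝ) :
    max (-lennardJones r) 0 ≤ 1 / 6 * r⁻¹ ^ 6 := by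
  have h6 : 0 ≤ r⁻¹ ^ 6 := by positivity
  have h12 : 0 ≤ r⁻¹ ^ 12 := by positivity
  refine max_le ?_ (by positivity)
  unfold lennardJones
  linarith

/-- **Row tail.** In a `7/10`-separated configuration of `ℝ³`, if every particle `k ∈ S` satisfies
`|x_j − x_k|⁻¹ ≤ a` (`a ≥ 0`), then `Σ_{k ∈ S} max(−V_LJ(|x_j − x_k|), 0) ≤ a · K / 6` for every
`K ≥ 250 · (7/10)⁻⁵`: termwise `max(−V_LJ(r), 0) ≤ r⁻⁶/6 ≤ a r⁻⁵/6`, then the shell sum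
`Σ_k |x_j − x_k|⁻⁵ ≤ 250 · (7/10)⁻⁵`. [folklore] -/
private theorem shellBound_row_le {N : ℕ} (x : Fin N → E3)
    (hsep : ∀ j k : Fin N, j ≠ k → (7 : ℝ) / 10 ≤ dist (x j) (x k)) {K : ℝ}
    (hK : 250 * ((7 : ℝ) / 10)⁻¹ ^ 5 ≤ K) (S : Finset (Fin N)) (j : Fin N) {a : ℝ} (ha : 0 ≤ a)
    (hS : ∀ k ∈ S, (dist (x j) (x k))⁻¹ ≤ a) :
    ∑ k ∈ S, max (-lennardJones (dist (x j) (x k))) 0 ≤ a * K / 6 := by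
  have h5 : ∑ k, (dist (x j) (x k))⁻¹ ^ 5 ≤ K :=
    (averaging_sum_inv_pow_five_le x (by norm_num : (0 : ℝ) < 7 / 10) hsep j).trans hK
  calc ∑ k ∈ S, max (-lennardJones (dist (x j) (x k))) 0
      ≤ ∑ k ∈ S, a / 6 * (dist (x j) (x k))⁻¹ ^ 5 := by
        refine Finset.sum_le_sum fun k hk => (shellBound_max_neg_lennardJones_le _).trans ?_
        have h0 : 0 ≤ (dist (x j) (x k))⁻¹ := inv_nonneg.2 dist_nonneg
        have h1 : (dist (x j) (x k))⁻¹ * (dist (x j) (x k))⁻¹ ^ 5 ≤ a * (dist (x j) (x k))⁻¹ ^ 5 :=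
          mul_le_mul_of_nonneg_right (hS k hk) (pow_nonneg h0 5)
        calc 1 / 6 * (dist (x j) (x k))⁻¹ ^ 6
            = 1 / 6 * ((dist (x j) (x k))⁻¹ * (dist (x j) (x k))⁻¹ ^ 5) := by ring
          _ ≤ 1 / 6 * (a * (dist (x j) (x k))⁻¹ ^ 5) := by linarith
          _ = a / 6 * (dist (x j) (x k))⁻¹ ^ 5 := by ring
    _ ≤ ∑ k, a / 6 * (dist (x j) (x k))⁻¹ ^ 5 :=
        Finset.sum_le_univ_sum_of_nonneg fun k => by positivity
    _ = a / 6 * ∑ k, (dist (x j) (x k))⁻¹ ^ 5 := by rw [Finset.mul_sum]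
    _ ≤ a / 6 * K := mul_le_mul_of_nonneg_left h5 (by positivity)
    _ = a * K / 6 := by ring

/-- **C5d — shell bound.** For a `7/10`-separated configuration, the attraction across the
boundary of a particle-centred closed `L`-ball is at most `ε` per particle of the ball plus `C` per
particle of the boundary shell `L − R < |x_j − x_i| ≤ L`: with `K = 250 · (7/10)⁻⁵`,
`R = max(1, K/(6ε))` and `C = (10/7) K / 6`, a deep particle (`|x_j − x_i| ≤ L − R`) is at distance
`> R` from every particle outside the ball (triangle inequality), so its row of attractions is
`≤ R⁻¹ K / 6 ≤ ε`, and every row is `≤ (10/7) K / 6 = C` since all mutual distances are `≥ 7/10`.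
[folklore] -/
theorem stub_shellBound :
    ∀ ε : ℝ, 0 < ε → ∃ R C : ℝ, 1 ≤ R ∧ 0 < C ∧ ∀ (N : ℕ) (x : Fin N → E3),
      (∀ j k : Fin N, j ≠ k → (7 : ℝ) / 10 ≤ dist (x j) (x k)) → ∀ (i : Fin N) (L : ℝ),
        ∑ j ∈ Finset.univ.filter (fun j : Fin N => dist (x j) (x i) ≤ L),
            ∑ k ∈ Finset.univ.filter (fun k : Fin N => ¬ dist (x k) (x i) ≤ L),
              max (-lennardJones (dist (x j) (x k))) 0 ≤
          ε * ((Finset.univ.filter fun j : Fin N => dist (x j) (x i) ≤ L).card : ℝ) +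
            C * ((Finset.univ.filter fun j : Fin N =>
              L - R < dist (x j) (x i) ∧ dist (x j) (x i) ≤ L).card : ℝ) := by
  intro ε hε
  obtain ⟨K, hKle, hK⟩ : ∃ K : ℝ, 250 * ((7 : ℝ) / 10)⁻¹ ^ 5 ≤ K ∧ 0 < K :=
    ⟨_, le_rfl, by positivity⟩
  obtain ⟨R, hR1, hRK⟩ : ∃ R : ℝ, 1 ≤ R ∧ K / (6 * ε) ≤ R :=
    ⟨max 1 (K / (6 * ε)), le_max_left _ _, le_max_right _ _⟩
  have hR0 : 0 < R := one_pos.trans_le hR1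
  obtain ⟨C, hCK, hC⟩ : ∃ C : ℝ, 10 / 7 * K / 6 ≤ C ∧ 0 < C := ⟨_, le_rfl, by positivity⟩
  refine ⟨R, C, hR1, hC, fun N x hsep i L => ?_⟩
  set B := Finset.univ.filter (fun j : Fin N => dist (x j) (x i) ≤ L) with hB_def
  set Bc := Finset.univ.filter (fun k : Fin N => ¬ dist (x k) (x i) ≤ L) with hBc_def
  -- deep rows: every exterior particle is at distance `> R`, so the row is `≤ R⁻¹ K / 6 ≤ ε`
  have hdeep : ∀ j : Fin N, dist (x j) (x i) ≤ L - R →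
      ∑ k ∈ Bc, max (-lennardJones (dist (x j) (x k))) 0 ≤ ε := by
    intro j hj
    have hrow : ∑ k ∈ Bc, max (-lennardJones (dist (x j) (x k))) 0 ≤ R⁻¹ * K / 6 :=
      shellBound_row_le x hsep hKle Bc j (inv_nonneg.2 hR0.le) fun k hk => by
        have hk' : L < dist (x k) (x i) := not_le.1 (Finset.mem_filter.1 hk).2
        have htri := dist_triangle (x k) (x j) (x i)
        rw [dist_comm (x k) (x j)] at htri
        exact inv_anti₀ hR0 (by linarith)
    have h1 : K ≤ R * (6 * ε) := (div_le_iff₀ (by positivity)).1 hRK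
    have h2 : R⁻¹ * K ≤ R⁻¹ * (R * (6 * ε)) := mul_le_mul_of_nonneg_left h1 (inv_nonneg.2 hR0.le)
    rw [← mul_assoc, inv_mul_cancel₀ hR0.ne', one_mul] at h2
    linarith
  -- all rows: every mutual distance is `≥ 7/10` (or `0` on the diagonal), so the row is `≤ C`
  have hshell : ∀ j : Fin N, ∑ k ∈ Bc, max (-lennardJones (dist (x j) (x k))) 0 ≤ C := by
    intro j
    have hrow : ∑ k ∈ Bc, max (-lennardJones (dist (x j) (x k))) 0 ≤ 10 / 7 * K / 6 :=
      shellBound_row_le x hsep hKle Bc j (by norm_num : (0 : ℝ) ≤ 10 / 7) fun k _ => by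
        rcases eq_or_ne j k with rfl | hjk
        · rw [dist_self, inv_zero]
          norm_num
        · calc (dist (x j) (x k))⁻¹ ≤ ((7 : ℝ) / 10)⁻¹ := inv_anti₀ (by norm_num) (hsep j k hjk)
            _ = 10 / 7 := by norm_num
    exact hrow.trans hCK
  -- every row of the ball: `≤ ε + C · 1[shell]`
  have hrowle : ∀ j ∈ B, ∑ k ∈ Bc, max (-lennardJones (dist (x j) (x k))) 0 ≤
      ε + C * (if L - R < dist (x j) (x i) ∧ dist (x j) (x i) ≤ L then (1 : ℝ) else 0) := by
    intro j hj
    have hjL : dist (x j) (x i) ≤ L := (Finset.mem_filter.1 hj).2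
    by_cases h : L - R < dist (x j) (x i)
    · rw [if_pos ⟨h, hjL⟩, mul_one]
      linarith [hshell j]
    · rw [if_neg fun h' => h h'.1, mul_zero, add_zero]
      exact hdeep j (by linarith)
  calc ∑ j ∈ B, ∑ k ∈ Bc, max (-lennardJones (dist (x j) (x k))) 0
      ≤ ∑ j ∈ B, (ε + C * (if L - R < dist (x j) (x i) ∧ dist (x j) (x i) ≤ L then (1 : ℝ) else 0)) :=
        Finset.sum_le_sum hrowle
    _ = ε * (B.card : ℝ) +
          C * ∑ j ∈ B, (if L - R < dist (x j) (x i) ∧ dist (x j) (x i) ≤ L then (1 : ℝ) else 0) := by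
        rw [Finset.sum_add_distrib, Finset.sum_const, nsmul_eq_mul, ← Finset.mul_sum]
        ring
    _ ≤ ε * (B.card : ℝ) +
          C * ∑ j, (if L - R < dist (x j) (x i) ∧ dist (x j) (x i) ≤ L then (1 : ℝ) else 0) := by
        refine add_le_add le_rfl (mul_le_mul_of_nonneg_left ?_ hC.le)
        exact Finset.sum_le_univ_sum_of_nonneg fun j => by positivity
    _ = ε * (B.card : ℝ) + C * ((Finset.univ.filter fun j : Fin N =>
          L - R < dist (x j) (x i) ∧ dist (x j) (x i) ≤ L).card : ℝ) := by
        rw [Finset.sum_boole]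

end Summit.AtomisticToContinuum.Crystallization.Theorems.LjLaminarWindowsSketch

end
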